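import Summits.QuantumFields.YangMills.Theorems.BalabanUVNodesN19ChebyshevCurrencyLinearPrice
import Summits.QuantumFields.YangMills.Theorems.BalabanUVNodesN19FixedTestLawPairs

/-!
# N19 (NE7, s3 ALTERNATIVE CURRENCY) — The two uniform-moment currencies are exponentially far apart

Module 99 of the `dag-n19-e` lineage (CURRENCY-MAP v3 item (w′), the quantitative edge between modules 96
and 98).

Module 90 (p611459) passes from `r`-close MONOMIAL moments to the Chebyshev moments at the price
`|∫T_j dμ − ∫T_j dν| ≤ 3^j r`; module 98 shows that `r`-close CHEBYSHEV moments control every Lipschitz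
observable linearly.  Here the exponential loss is shown to be NECESSARY, per step: the half-scale
Chebyshev-arc laws of module 88 at level `n ≥ 3` have ALL monomial moments within `4·2^{−n}` of each
other, yet by module 98 their Chebyshev moments differ by at least `√3∕(4πn)` at some order `l ≥ 1`
(★★ `exists_monomial_close_chebyshev_far`): the two «uniform moment» currencies of the lineage are
separated by a factor `≥ 2^n∕n` at level `n`, and (★ `chebyshev_discrepancy_ge_of_payment`) in general a
payment `p` to a `K`-Lipschitz observable forces a Chebyshev discrepancy `≥ (√3∕(πK))·p`.

HONEST FRAMING: [folklore] bookkeeping over modules 88 and 98 BY NAME; TOY laws; no consumer in the DAG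
today; nothing of Bałaban's is instantiated; NE7 is NOT PRINTED and NOT proved here; N19 is NOT
discharged; count-neutral.  One finite 𝕋⁴ programme at fixed ε; nothing continuum ∕ OS ∕ mass-gap ∕ Clay.
-/

open Real MeasureTheory Polynomial.Chebyshev

namespace Summit.QuantumFields.YangMills.Theorems.BalabanUVNodesN19MonomialVsChebyshevSeparation

open BalabanUVNodesN19ChebyshevCurrencyLinearPrice BalabanUVNodesN19LipschitzChebyshevCoefficients

/-- ★ A PAYMENT FORCES A CHEBYSHEV DISCREPANCY: if a continuous `K`-Lipschitz observable `G` (`K > 0`) is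
paid `p ≤ |∫G dμ − ∫G dν|` by two probability laws on `[−1,1]`, then every uniform bound `r` on their
Chebyshev-moment differences satisfies `r ≥ (√3∕(πK))·p`. (Contrapositive of module 98.) [folklore] -/
theorem chebyshev_discrepancy_ge_of_payment {G : ℝ → ℝ} {K : ℝ} (hG : Continuous G) (hKpos : 0 < K)
    (hK : ∀ x y : ℝ, x ∈ Set.Icc (-1 : ℝ) 1 → y ∈ Set.Icc (-1 : ℝ) 1 → |G x - G y| ≤ K * |x - y|)
    (μ ν : Measure ℝ) [IsProbabilityMeasure μ] [IsProbabilityMeasure ν]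
    (hμ : μ (Set.Icc (-1 : ℝ) 1)ᶜ = 0) (hν : ν (Set.Icc (-1 : ℝ) 1)ᶜ = 0) {p r : ℝ}
    (hp : p ≤ |∫ x, G x ∂μ - ∫ x, G x ∂ν|)
    (hr : ∀ l : ℕ, 1 ≤ l → |∫ x, (T ℝ l).eval x ∂μ - ∫ x, (T ℝ l).eval x ∂ν| ≤ r) :
    Real.sqrt 3 / (π * K) * p ≤ r := by
  have h := hp.trans (abs_integral_sub_le_of_chebyshev hG hK μ ν hμ hν hr)
  have h3 : 0 < Real.sqrt 3 := Real.sqrt_pos.2 (by norm_num)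
  rw [div_mul_eq_mul_div, div_le_iff₀ (by positivity)]
  calc Real.sqrt 3 * p ≤ Real.sqrt 3 * (π * K / Real.sqrt 3 * r) := mul_le_mul_of_nonneg_left h h3.le
    _ = r * (π * K) := by field_simp

/-- ★★ **MONOMIAL-CLOSE, CHEBYSHEV-FAR.**  For every `n ≥ 3` there are probability laws `P, Q` on
`[−1,1]` whose MONOMIAL moments are ALL within `4·(½)^n` of each other while their CHEBYSHEV moments
are NOT uniformly closer than `√3∕(4πn)`: every uniform bound `r` on `|∫T_l dP − ∫T_l dQ|`, `l ≥ 1`, has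
`r ≥ √3∕(4πn)`.  (Module 88's half-scale Chebyshev-arc laws pay a
1-Lipschitz test `1∕(4n)`; module 98.)  So the passage monomial → Chebyshev of module 90 must lose a
factor `≥ 2^n√3∕(16πn)` at level `n`: the two uniform-moment currencies are exponentially far apart, which
is the room in which modules 96 (NO) and 98 (YES) coexist. [folklore] -/
theorem exists_monomial_close_chebyshev_far {n : ℕ} (hn : 3 ≤ n) :
    ∃ P Q : Measure ℝ, IsProbabilityMeasure P ∧ IsProbabilityMeasure Q ∧
      P (Set.Icc (-1 : ℝ) 1)ᶜ = 0 ∧ Q (Set.Icc (-1 : ℝ) 1)ᶜ = 0 ∧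
      (∀ j : ℕ, |∫ x, x ^ j ∂P - ∫ x, x ^ j ∂Q| ≤ 4 * (1 / 2 : ℝ) ^ n) ∧
      (∀ r : ℝ, (∀ l : ℕ, 1 ≤ l → |∫ x, (T ℝ l).eval x ∂P - ∫ x, (T ℝ l).eval x ∂Q| ≤ r) →
        Real.sqrt 3 / (4 * π * n) ≤ r) := by
  obtain ⟨P, Q, iP, iQ, hPc, hQc, -, -, -, hmom, g, hgc, hgL, -, hpay⟩ :=
    BalabanUVNodesN19FixedTestLawPairs.exists_halfScale_chebyshevArc_laws_ident hn
  have hnr : (0 : ℝ) < n := by exact_mod_cast (show 0 < n by omega)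
  have hmomPQ : ∀ j : ℕ, |∫ x, x ^ j ∂P - ∫ x, x ^ j ∂Q| ≤ 4 * (1 / 2 : ℝ) ^ n := by
    intro j
    obtain ⟨h1, h2⟩ := hmom j
    calc |∫ x, x ^ j ∂P - ∫ x, x ^ j ∂Q|
        = |(∫ x, x ^ j ∂P - 1 / 2 * ∫ x in (-1 : ℝ)..1, (x / 2) ^ j) -
            (∫ x, x ^ j ∂Q - 1 / 2 * ∫ x in (-1 : ℝ)..1, (x / 2) ^ j)| := by ring_nf
      _ ≤ |∫ x, x ^ j ∂P - 1 / 2 * ∫ x in (-1 : ℝ)..1, (x / 2) ^ j| +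
            |∫ x, x ^ j ∂Q - 1 / 2 * ∫ x in (-1 : ℝ)..1, (x / 2) ^ j| := abs_sub _ _
      _ ≤ 2 * (1 / 2 : ℝ) ^ n + 2 * (1 / 2 : ℝ) ^ n := add_le_add h1 h2
      _ = 4 * (1 / 2 : ℝ) ^ n := by ring
  have hfar : ∀ r : ℝ, (∀ l : ℕ, 1 ≤ l → |∫ x, (T ℝ l).eval x ∂P - ∫ x, (T ℝ l).eval x ∂Q| ≤ r) →
      Real.sqrt 3 / (4 * π * n) ≤ r := by
    intro r hr
    have h := chebyshev_discrepancy_ge_of_payment hgc one_pos hgL P Q hPc hQc (p := 1 / (4 * n))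
      (by rw [hpay]; exact le_abs_self _) hr
    calc Real.sqrt 3 / (4 * π * n) = Real.sqrt 3 / (π * 1) * (1 / (4 * n)) := by field_simp
      _ ≤ r := h
  exact ⟨P, Q, iP, iQ, hPc, hQc, hmomPQ, hfar⟩

end Summit.QuantumFields.YangMills.Theorems.BalabanUVNodesN19MonomialVsChebyshevSeparation
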